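import Literature.RepresentationTheory.FiniteGroups.GL2ModularPrincipalSeriesLatticeSocleModel
import Literature.RepresentationTheory.StableLatticeIrreducibleSocleUnique
import HarnessLib

/-!
# Uniqueness up to homothety of the stable lattice of a tame principal-series type with prescribed socle
# (Emerton–Gee–Savitt, Lemma 4.1.1, applied to `Ind(χ₁ ⊗ χ₂)` of `GL₂(𝔽_p)`)

Topic `Literature/RepresentationTheory/FiniteGroups`, namespace `Literature.RepresentationTheory.FiniteGroups.GL2`.
THEOREMS (+ the coordinate isomorphism `modelCoord`); no named fact, no instance, no notation, no `sorry`.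

M. Emerton, T. Gee, D. Savitt, *Lattices in the cohomology of Shimura curves*, Invent. Math. 200 (2015),
Lemma 4.1.1: in a residually multiplicity-free irreducible `E`-representation `σ` of `GL₂`, for each Jordan–Hölder
factor `σ̄ᵢ` of the reduction there is, up to homothety, a UNIQUE stable `𝒪`-lattice whose reduction has socle
`σ̄ᵢ`; §3.2: for the tame principal-series type `σ = Ind(χ₁ ⊗ χ₂)` (`χ̄₁ ≠ χ̄₂ = χ̄₁ε^r`) the lattice with socle
`Sym^r ⊗ χ̄₁∘det` is the function lattice `Fun_𝒪(Ind(χ₁ ⊗ χ₂))`.  Here, with the tree's general lattice lemma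
`Literature.RepresentationTheory.exists_smul_eq_smul_of_socle` (`StableLatticeIrreducibleSocleUnique`) and the
group-ring structure of `L₀/ϖL₀` (`GL2ModularPrincipalSeriesLatticeSocle`):

* side conditions on a model `ρ₀ ≃ Fun_R(Ind(χ₁ ⊗ χ₂))` (`modelCoord`): `ϖ` and its powers act injectively
  (`eq_zero_of_smul_eq_zero`, `eq_zero_of_pow_smul_eq_zero`), `ϖ`-adic separatedness relative to a sublattice
  (`eq_zero_of_forall_mem_pow_smul`), `⊤ ≠ ⊥`, cancellation of `ϖⁿ` on submodules, `#(L₀/ϖL₀) = #k^(p+1)`;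
* **`exists_pow_smul_top_eq_pow_smul`** — for `R ↠ k` (char `p`, kernel `(ϖ)`, `ϖ` a non-zero-divisor,
  `⋂ ϖʲR = 0`: e.g. `ℤ_p → 𝔽_p`), every `GL₂(𝔽_p)`-stable `R`-lattice `Λ ⊆ ρ₀` of finite index with
  `#(Λ/ϖΛ) ≤ #k^(p+1)` whose reduction has every nonzero `R[GL₂(𝔽_p)]`-submodule receiving the socle
  `Sym^r ⊗ χ̄₁∘det` injectively satisfies `ϖᵐρ₀ = ϖʲΛ`;
* **`exists_eq_pow_smul_top`** — hence `Λ = ϖᶜ ρ₀`: the standard lattice is THE stable lattice with that socle;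
* **`exists_eq_pow_smul_top_of_symPow`** — the same with the socle hypothesis phrased through the canonical module
  `Sym^r(k²) ⊗ (χ̄₁ ∘ det)` (via `modelSocleEquiv`).

Sequel `GL2ModularPrincipalSeriesLatticeUniquePID`: over a PID (e.g. `ℤ_p`) the cardinality/finiteness hypotheses are
automatic.

Intended use (the «tame-type lattice» mechanism for the Manin constant at potentially good ordinary primes, K-line
of `TwistedPeriodLatticeSaturation`): `R = ℤ_p`, `k = 𝔽_p`, `χᵢ` Teichmüller powers, `Λ` the `f`-part of the
`p`-adic homology of `X(K(p)K₀(M))`; no number theory is formalised here.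
-/

noncomputable section

namespace Literature.RepresentationTheory.FiniteGroups

namespace GL2

open Function Pointwise
open Literature.NumberTheory.Automorphic (TwistedQuotient.resScalars TwistedQuotient.resScalars_apply)

section Main

variable (p : ℕ) [Fact p.Prime] {R : Type} [CommRing R] {k : Type} [Field k] [CharP k p] [Algebra R k]
  (χ₁ χ₂ : (ZMod p)ˣ →* Rˣ) {V₀ : Type} [AddCommGroup V₀] [Module R V₀]
  {ρ₀ : Representation R (GL (Fin 2) (ZMod p)) V₀} (e₀ : ρ₀.Equiv (principalSeriesRep (ZMod p) χ₁ χ₂)) {r s : ℕ}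

include e₀

/-- Bruhat coordinates on the model: `v ↦` coordinates of `e₀ v`, an `R`-linear isomorphism
`ρ₀.asModule ≃ (Option 𝔽_p → R)`. [cite: EmertonGeeSavitt2015, Lemma 4.1.1] -/
def modelCoord : ρ₀.asModule ≃ₗ[R] (Option (ZMod p) → R) :=
  (ρ₀.asModuleEquiv.trans e₀.toLinearEquiv).trans (bruhatEquiv χ₁ χ₂)

/-- A non-zero-divisor `ϖ` of `R` acts injectively on the model of `Fun_R(Ind(χ₁ ⊗ χ₂))` (a free `R`-module). [cite: EmertonGeeSavitt2015, Lemma 4.1.1] -/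
theorem eq_zero_of_smul_eq_zero {ϖ : R} (hreg : ∀ a : R, ϖ * a = 0 → a = 0) (v : ρ₀.asModule)
    (hv : ϖ • v = 0) : v = 0 := by
  apply (modelCoord p χ₁ χ₂ e₀).injective
  rw [map_zero]
  have h := congrArg (modelCoord p χ₁ χ₂ e₀) hv
  rw [LinearEquiv.map_smul, map_zero] at h
  funext o
  exact hreg _ (by simpa using congrFun h o)

/-- Powers of a non-zero-divisor act injectively on the model. [cite: EmertonGeeSavitt2015, Lemma 4.1.1] -/
theorem eq_zero_of_pow_smul_eq_zero {ϖ : R} (hreg : ∀ a : R, ϖ * a = 0 → a = 0) (n : ℕ) (v : ρ₀.asModule)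
    (hv : ϖ ^ n • v = 0) : v = 0 := by
  induction n generalizing v with
  | zero => simpa using hv
  | succ n ih =>
    rw [pow_succ, mul_smul] at hv
    exact ih v (eq_zero_of_smul_eq_zero p χ₁ χ₂ e₀ hreg _ (by rw [smul_comm] at hv; exact hv))

/-- The model is `ϖ`-adically separated relative to any sublattice: an element lying in every `ϖʲ • Λ` is `0`
(when `⋂ ϖʲR = 0`). [cite: EmertonGeeSavitt2015, Lemma 4.1.1] -/
theorem eq_zero_of_forall_mem_pow_smul {ϖ : R} (hsepR : ∀ a : R, (∀ j : ℕ, ϖ ^ j ∣ a) → a = 0)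
    (Λ : Submodule (MonoidAlgebra R (GL (Fin 2) (ZMod p))) ρ₀.asModule) (x : ρ₀.asModule)
    (hx : ∀ j : ℕ, x ∈ ϖ ^ j • Λ) : x = 0 := by
  apply (modelCoord p χ₁ χ₂ e₀).injective
  rw [map_zero]
  funext o
  refine hsepR _ fun j => ?_
  obtain ⟨y, -, hy⟩ : ∃ y ∈ (Λ : Set ρ₀.asModule), ϖ ^ j • y = x := by
    have := hx j
    rwa [← SetLike.mem_coe, Submodule.coe_pointwise_smul, Set.mem_smul_set] at this
  refine ⟨modelCoord p χ₁ χ₂ e₀ y o, ?_⟩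
  rw [← hy, LinearEquiv.map_smul]
  rfl

/-- The model is nonzero (`R` nontrivial). [cite: EmertonGeeSavitt2015, Lemma 4.1.1] -/
theorem top_ne_bot_model [Nontrivial R] :
    (⊤ : Submodule (MonoidAlgebra R (GL (Fin 2) (ZMod p))) ρ₀.asModule) ≠ ⊥ := by
  intro h
  have hmem : (modelCoord p χ₁ χ₂ e₀).symm (fun _ => 1) ∈
      (⊤ : Submodule (MonoidAlgebra R (GL (Fin 2) (ZMod p))) ρ₀.asModule) := Submodule.mem_top
  rw [h, Submodule.mem_bot, LinearEquiv.map_eq_zero_iff] at hmem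
  exact one_ne_zero (congrFun hmem none)

/-- Cancellation of `ϖⁿ` on submodules of the model. [cite: EmertonGeeSavitt2015, Lemma 4.1.1] -/
theorem eq_of_pow_smul_eq_pow_smul {ϖ : R} (hreg : ∀ a : R, ϖ * a = 0 → a = 0) (n : ℕ)
    {N₁ N₂ : Submodule (MonoidAlgebra R (GL (Fin 2) (ZMod p))) ρ₀.asModule} (h : ϖ ^ n • N₁ = ϖ ^ n • N₂) :
    N₁ = N₂ := by
  suffices key : ∀ {N₁ N₂ : Submodule (MonoidAlgebra R (GL (Fin 2) (ZMod p))) ρ₀.asModule},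
      ϖ ^ n • N₁ = ϖ ^ n • N₂ → N₁ ≤ N₂ from le_antisymm (key h) (key h.symm)
  intro N₁ N₂ h x hx
  have hx' : ϖ ^ n • x ∈ ϖ ^ n • N₂ := h ▸ Submodule.smul_mem_pointwise_smul x (ϖ ^ n) N₁ hx
  rw [← SetLike.mem_coe, Submodule.coe_pointwise_smul, Set.mem_smul_set] at hx'
  obtain ⟨y, hy, hyx⟩ := hx'
  have : y - x = 0 := eq_zero_of_pow_smul_eq_zero p χ₁ χ₂ e₀ hreg n _ (by rw [smul_sub, hyx, sub_self])
  rw [sub_eq_zero] at this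
  exact this ▸ hy

omit [CharP k p] in
/-- **The number of elements of `L₀/ϖL₀`** is `#k^(p+1)` (`L₀/ϖL₀ ≅ Fun_k(Ind(χ̄₁ ⊗ χ̄₂)) ≅ k^{ℙ¹(𝔽_p)}`). [cite: EmertonGeeSavitt2015, Lemma 4.1.1] -/
theorem natCard_modelQuot {ϖ : R} (hker : ∀ a : R, algebraMap R k a = 0 ↔ ϖ ∣ a)
    (hsurj : Surjective (algebraMap R k)) :
    Nat.card (↥(⊤ : Submodule (MonoidAlgebra R (GL (Fin 2) (ZMod p))) ρ₀.asModule) ⧸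
        (ϖ • (⊤ : Submodule (MonoidAlgebra R (GL (Fin 2) (ZMod p))) ρ₀.asModule)).comap
          (⊤ : Submodule (MonoidAlgebra R (GL (Fin 2) (ZMod p))) ρ₀.asModule).subtype) =
      Nat.card k ^ (p + 1) := by
  rw [Nat.card_congr (modelReduceQuotEquiv (k := k) χ₁ χ₂ e₀ hker hsurj).toEquiv]
  change Nat.card (Option (ZMod p) → k) = _
  rw [Nat.card_fun, Nat.card_eq_fintype_card (α := Option (ZMod p)), Fintype.card_option, ZMod.card]

/-- **EGS Lemma 4.1.1 for the tame principal-series type — relative form.**  Let `R → k` be onto a field of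
characteristic `p` with kernel `(ϖ)`, `ϖ` a non-zero-divisor with `⋂ⱼ ϖʲR = 0` (e.g. `ℤ_p → 𝔽_p`, `ϖ = p`); let
`χ₁, χ₂ : 𝔽_pˣ → Rˣ` have reductions `χ̄₁ ≠ χ̄₂ = χ̄₁ε^r`, `r + s = p − 1`; let `ρ₀ ≃ Fun_R(Ind(χ₁ ⊗ χ₂))` be a
model of the integral principal series and `Λ ⊆ ρ₀` a `GL₂(𝔽_p)`-stable `R`-lattice of finite index
(`ϖᵐρ₀ ⊆ Λ`) whose reduction `Λ/ϖΛ` has at most `#k^(p+1)` elements and has SOCLE `⊆ {Sym^r ⊗ χ̄₁∘det}`: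
every nonzero `R[GL₂(𝔽_p)]`-submodule of `Λ/ϖΛ` receives an injective map from the socle `S` of `ρ₀/ϖρ₀`.  Then
`Λ` is HOMOTHETIC to `ρ₀`: `ϖᵐ ρ₀ = ϖʲ Λ` for some `j`. [cite: EmertonGeeSavitt2015, Lemma 4.1.1] -/
theorem exists_pow_smul_top_eq_pow_smul {ϖ : R} (hreg : ∀ a : R, ϖ * a = 0 → a = 0)
    (hsepR : ∀ a : R, (∀ j : ℕ, ϖ ^ j ∣ a) → a = 0)
    (hker : ∀ a : R, algebraMap R k a = 0 ↔ ϖ ∣ a) (hsurj : Surjective (algebraMap R k))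
    (hχne : reduceChar k χ₁ ≠ reduceChar k χ₂)
    (hχ : ∀ a : (ZMod p)ˣ, (reduceChar k χ₂ a : k) = (reduceChar k χ₁ a : k) * ZMod.castHom (dvd_refl p) k a ^ r)
    (hrs : r + s = p - 1)
    (Λ : Submodule (MonoidAlgebra R (GL (Fin 2) (ZMod p))) ρ₀.asModule) {m : ℕ}
    (hm : ϖ ^ m • (⊤ : Submodule (MonoidAlgebra R (GL (Fin 2) (ZMod p))) ρ₀.asModule) ≤ Λ)
    [Finite (↥Λ ⧸ (ϖ • Λ).comap Λ.subtype)]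
    (hcard : Nat.card (↥Λ ⧸ (ϖ • Λ).comap Λ.subtype) ≤ Nat.card k ^ (p + 1))
    (hsoc : ∀ N : Submodule (MonoidAlgebra R (GL (Fin 2) (ZMod p))) (↥Λ ⧸ (ϖ • Λ).comap Λ.subtype), N ≠ ⊥ →
      ∃ f : ↥(modelSocle p χ₁ χ₂ e₀ hker hsurj hχ) →ₗ[MonoidAlgebra R (GL (Fin 2) (ZMod p))] ↥N, Injective f) :
    ∃ j : ℕ, ϖ ^ m • (⊤ : Submodule (MonoidAlgebra R (GL (Fin 2) (ZMod p))) ρ₀.asModule) = ϖ ^ j • Λ := by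
  have hp : 2 ≤ p := (Fact.out : p.Prime).two_le
  have hr : r < p := by omega
  haveI : Nontrivial R := (algebraMap R k).domain_nontrivial
  refine exists_smul_eq_smul_of_socle ϖ (eq_zero_of_smul_eq_zero p χ₁ χ₂ e₀ hreg) hm
    ⟨0, by rw [pow_zero, one_smul]; exact le_top⟩ (top_ne_bot_model p χ₁ χ₂ e₀)
    (fun x _ hx => eq_zero_of_forall_mem_pow_smul p χ₁ χ₂ e₀ hsepR Λ x hx)
    (by rwa [natCard_modelQuot p χ₁ χ₂ e₀ hker hsurj]) (fun N hN => ?_) hsoc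
    (fun N hf hg => not_socle_embeds_twice p χ₁ χ₂ e₀ hker hsurj hχne hχ hrs N hf hg)
  exact ⟨Submodule.inclusion (modelSocle_le_of_ne_bot p χ₁ χ₂ e₀ hker hsurj hχne hχ hr N hN),
    Submodule.inclusion_injective _⟩

/-- **EGS Lemma 4.1.1 for the tame principal-series type — absolute form**: under the hypotheses of
`exists_pow_smul_top_eq_pow_smul`, the lattice `Λ` IS `ϖᶜ ρ₀` for some `c` (the standard lattice
`Fun_R(Ind(χ₁ ⊗ χ₂))` is, up to homothety, the unique stable lattice whose reduction has socle
`Sym^r ⊗ χ̄₁∘det`). [cite: EmertonGeeSavitt2015, Lemma 4.1.1] -/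
theorem exists_eq_pow_smul_top {ϖ : R} (hreg : ∀ a : R, ϖ * a = 0 → a = 0)
    (hsepR : ∀ a : R, (∀ j : ℕ, ϖ ^ j ∣ a) → a = 0)
    (hker : ∀ a : R, algebraMap R k a = 0 ↔ ϖ ∣ a) (hsurj : Surjective (algebraMap R k))
    (hχne : reduceChar k χ₁ ≠ reduceChar k χ₂)
    (hχ : ∀ a : (ZMod p)ˣ, (reduceChar k χ₂ a : k) = (reduceChar k χ₁ a : k) * ZMod.castHom (dvd_refl p) k a ^ r)
    (hrs : r + s = p - 1)
    (Λ : Submodule (MonoidAlgebra R (GL (Fin 2) (ZMod p))) ρ₀.asModule) {m : ℕ}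
    (hm : ϖ ^ m • (⊤ : Submodule (MonoidAlgebra R (GL (Fin 2) (ZMod p))) ρ₀.asModule) ≤ Λ)
    [Finite (↥Λ ⧸ (ϖ • Λ).comap Λ.subtype)]
    (hcard : Nat.card (↥Λ ⧸ (ϖ • Λ).comap Λ.subtype) ≤ Nat.card k ^ (p + 1))
    (hsoc : ∀ N : Submodule (MonoidAlgebra R (GL (Fin 2) (ZMod p))) (↥Λ ⧸ (ϖ • Λ).comap Λ.subtype), N ≠ ⊥ →
      ∃ f : ↥(modelSocle p χ₁ χ₂ e₀ hker hsurj hχ) →ₗ[MonoidAlgebra R (GL (Fin 2) (ZMod p))] ↥N, Injective f) :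
    ∃ c : ℕ, Λ = ϖ ^ c • (⊤ : Submodule (MonoidAlgebra R (GL (Fin 2) (ZMod p))) ρ₀.asModule) := by
  obtain ⟨j, hj⟩ := exists_pow_smul_top_eq_pow_smul p χ₁ χ₂ e₀ hreg hsepR hker hsurj hχne hχ hrs Λ hm hcard hsoc
  by_cases hjm : j ≤ m
  · -- `ϖʲ (ϖ^{m-j} ⊤) = ϖʲ Λ`: cancel `ϖʲ`
    refine ⟨m - j, (eq_of_pow_smul_eq_pow_smul p χ₁ χ₂ e₀ hreg j ?_).symm⟩
    rw [smul_smul, ← pow_add, Nat.add_sub_cancel' hjm, hj]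
  · -- `j > m` would force `⊤ ≤ ϖ ⊤`, i.e. the (surjective, nonzero) reduction to vanish
    exfalso
    have hmj : m < j := Nat.lt_of_not_le hjm
    have htop : (⊤ : Submodule (MonoidAlgebra R (GL (Fin 2) (ZMod p))) ρ₀.asModule) = ϖ ^ (j - m) • Λ := by
      apply eq_of_pow_smul_eq_pow_smul p χ₁ χ₂ e₀ hreg m
      rw [hj, smul_smul, ← pow_add, Nat.add_sub_cancel' hmj.le]
    obtain ⟨d, hd⟩ : ∃ d, j - m = d + 1 := ⟨j - m - 1, by omega⟩
    have hle : (⊤ : Submodule (MonoidAlgebra R (GL (Fin 2) (ZMod p))) ρ₀.asModule) ≤ ϖ • ⊤ := by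
      intro x hx
      rw [htop, hd, pow_succ', mul_smul] at hx
      rw [← SetLike.mem_coe, Submodule.coe_pointwise_smul, Set.mem_smul_set] at hx ⊢
      obtain ⟨y, -, rfl⟩ := hx
      exact ⟨y, Submodule.mem_top, rfl⟩
    -- the reduction is then identically zero, yet onto a nonzero module
    haveI : Nontrivial R := (algebraMap R k).domain_nontrivial
    obtain ⟨v, hv⟩ := modelReduceLinear_surjective (k := k) χ₁ χ₂ e₀ hsurj
      ((TwistedQuotient.resScalars R (coordRep (reduceChar k χ₁) (reduceChar k χ₂))).asModuleEquiv.symm fun _ => 1)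
    have hv0 : modelReduceLinear (k := k) χ₁ χ₂ e₀ v = 0 := by
      rw [← LinearMap.mem_ker, ker_modelReduceLinear χ₁ χ₂ e₀ hker]
      exact hle Submodule.mem_top
    rw [hv, LinearEquiv.map_eq_zero_iff] at hv0
    exact one_ne_zero (congrFun hv0 none)

/-- **EGS Lemma 4.1.1 for the tame principal-series type — socle hypothesis in terms of `Sym^r ⊗ χ̄₁∘det`.**
Same statement as `exists_eq_pow_smul_top`, with the socle condition on `Λ/ϖΛ` phrased through the canonical
module `Sym^r(k²) ⊗ (χ̄₁ ∘ det)` (restricted to `R[GL₂(𝔽_p)]`): every nonzero `R[GL₂(𝔽_p)]`-submodule of `Λ/ϖΛ`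
receives an injective `R[GL₂(𝔽_p)]`-linear map from `Sym^r ⊗ χ̄₁∘det`.  Then `Λ = ϖᶜ ρ₀`. [cite: EmertonGeeSavitt2015, Lemma 4.1.1] -/
theorem exists_eq_pow_smul_top_of_symPow {ϖ : R} (hreg : ∀ a : R, ϖ * a = 0 → a = 0)
    (hsepR : ∀ a : R, (∀ j : ℕ, ϖ ^ j ∣ a) → a = 0)
    (hker : ∀ a : R, algebraMap R k a = 0 ↔ ϖ ∣ a) (hsurj : Surjective (algebraMap R k))
    (hχne : reduceChar k χ₁ ≠ reduceChar k χ₂)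
    (hχ : ∀ a : (ZMod p)ˣ, (reduceChar k χ₂ a : k) = (reduceChar k χ₁ a : k) * ZMod.castHom (dvd_refl p) k a ^ r)
    (hrs : r + s = p - 1)
    (Λ : Submodule (MonoidAlgebra R (GL (Fin 2) (ZMod p))) ρ₀.asModule) {m : ℕ}
    (hm : ϖ ^ m • (⊤ : Submodule (MonoidAlgebra R (GL (Fin 2) (ZMod p))) ρ₀.asModule) ≤ Λ)
    [Finite (↥Λ ⧸ (ϖ • Λ).comap Λ.subtype)]
    (hcard : Nat.card (↥Λ ⧸ (ϖ • Λ).comap Λ.subtype) ≤ Nat.card k ^ (p + 1))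
    (hsoc : ∀ N : Submodule (MonoidAlgebra R (GL (Fin 2) (ZMod p))) (↥Λ ⧸ (ϖ • Λ).comap Λ.subtype), N ≠ ⊥ →
      ∃ f : (TwistedQuotient.resScalars R
          (symPowTwist (ZMod.castHom (dvd_refl p) k) (reduceChar k χ₁) r)).asModule
            →ₗ[MonoidAlgebra R (GL (Fin 2) (ZMod p))] ↥N, Injective f) :
    ∃ c : ℕ, Λ = ϖ ^ c • (⊤ : Submodule (MonoidAlgebra R (GL (Fin 2) (ZMod p))) ρ₀.asModule) := by
  have hp : 2 ≤ p := (Fact.out : p.Prime).two_le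
  have hr : r < p := by omega
  refine exists_eq_pow_smul_top p χ₁ χ₂ e₀ hreg hsepR hker hsurj hχne hχ hrs Λ hm hcard fun N hN => ?_
  obtain ⟨f, hf⟩ := hsoc N hN
  exact ⟨f.comp (modelSocleEquiv p χ₁ χ₂ e₀ hker hsurj hχ hr).symm.toLinearMap,
    hf.comp (modelSocleEquiv p χ₁ χ₂ e₀ hker hsurj hχ hr).symm.injective⟩

end Main

end GL2

end Literature.RepresentationTheory.FiniteGroups
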